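import Summits.KontsevichZagierPeriods.KontsevichZagierPeriods.Theorems.LinRedNormalFormArrangementNormalFormStubRebaseSimpleZeroManyChainBlowMap

/-!
# Stub `stub_rebaseSimpleZeroMany`, part `rebaseSimpleZeroMany_common` (crux `ArrangementNormalForm`,
line `janus-bands`) — brick `ChainBlow`

**The pinch-vertex blow-up move for a clean chain** `A < t₀ < ⋯ < tₙ < B` of `n + 1` fibres
over the one-dimensional base cell `{0 < ε₁ (y − y₀) < δ}` (constant letters, simple base pole AT
`y₀`), whose bounds pass through the pinch vertex `(y₀, t₀)` and ALL of whose letters sit at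
the vertex level `t₀`: ONE change of variables (rule 2), the `Z`-chart of brick `ChainBlowMap`
(`y = y₀ + ε₁ Z`, `tₗ = t₀ + aₗ Z`, Jacobian `Z^{n+1}`), lands LITERALLY in `GG 0 2 (n + 1)`:
the new base cell is `0 < Z < δ`, the new fibres form the clean chain `ε₁ A' < a₀ < ⋯ < aₙ < ε₁ B'`
with CONSTANT bounds, the poles `1/(tₗ − t₀) = 1/(aₗ Z)` become the constant letters `1/aₗ`,
and the base factor `1/(y − y₀) · Z^{n+1} · Z^{−#poles}` is the monomial `Z^{n − #poles}`
(`n₁ = n − #poles`, `n₂ = 0`; or `1/Z` if every fibre carries a pole). Result: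
`RebaseChain.IsChain.good_blowZ`; registered: `rebaseSimpleZeroMany_chainBlowZ`.
(When some letter is NOT at the vertex level the chart produces the non-affine letter
`1/(aₗ Z + t₀ − c)`; that configuration is not a `Z`-chart case.)

References: M. Kontsevich, D. Zagier, *Periods* (2001), §1.2, rule (2).
-/

noncomputable section

open Set MeasureTheory MvPolynomial
open Literature.NumberTheory.Transcendental Literature.ModelTheory.ExponentialFields

namespace Summit.KontsevichZagierPeriods.ArrangementNormalForm.JanusBands

namespace RebaseChain

open SeparatePos RebasePos RebaseZero RebaseNest

variable {k : ℕ}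

/-! ### The literal integrand over a one-dimensional base -/

/-- The literal integrand over a one-dimensional base, in coordinates. [folklore] -/
theorem glit_b0 {m : ℕ} (p : MvPolynomial (Fin 0) ℚ) (L : Fin m → (Fin 0 → ℚ) × ℚ) (e : Fin m → ℕ)
    (ℓ₁ ℓ₂ : (Fin 0 → ℚ) × ℚ) (n₁ n₂ : ℕ) (a : Fin k → Option Cf) (z : Fin (0 + 1 + k) → ℝ) :
    glit 0 k p L e ℓ₁ ℓ₂ n₁ n₂ a z = ((p.coeff 0 : ℚ) : ℝ) / (∏ j, ((L j).2 : ℝ) ^ e j) *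
      ((yv z - ℓ₁.2) ^ n₁ / (yv z - ℓ₂.2) ^ n₂) * ∏ l, (a l).elim 1 fun c => 1 / (tv z l - ev c (yv z)) := by
  have hp : MvPolynomial.aeval (fun i : Fin 0 => z (Fin.castAdd k (Fin.castSucc i))) p = ((p.coeff 0 : ℚ) : ℝ) := by
    conv_lhs => rw [MvPolynomial.eq_C_of_isEmpty p]
    rw [MvPolynomial.aeval_C, eq_ratCast]
  rw [glit_eq, hp]
  simp only [affB, Finset.univ_eq_empty, Finset.sum_empty, zero_add, fib, sum_eq]
  rfl

/-- Products over the lettered fibres split factorwise. [folklore] -/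
theorem prod_elim_mul (a : Fin k → Option Cf) (f g : Fin k → Cf → ℝ) :
    ∏ l, (a l).elim (1 : ℝ) (fun c => f l c * g l c) =
      (∏ l, (a l).elim (1 : ℝ) (f l)) * ∏ l, (a l).elim (1 : ℝ) (g l) := by
  rw [← Finset.prod_mul_distrib]
  refine Finset.prod_congr rfl fun l _ => ?_
  cases a l <;> simp

/-- A constant factor on every lettered fibre gives a power. [folklore] -/
theorem prod_elim_const (a : Fin k → Option Cf) (x : ℝ) :
    ∏ l, (a l).elim (1 : ℝ) (fun _ => x) = x ^ (Finset.univ.filter fun l => (a l).isSome).card := by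
  classical
  rw [← Finset.prod_filter_mul_prod_filter_not Finset.univ (fun l => (a l).isSome), ← Finset.prod_const]
  have h2 : ∏ l ∈ Finset.univ.filter (fun l => ¬ (a l).isSome), (a l).elim (1 : ℝ) (fun _ => x) = 1 :=
    Finset.prod_eq_one fun l hl => by
      rw [Finset.mem_filter, Option.isSome_iff_exists] at hl
      rcases h : a l with _ | c
      · rfl
      · exact absurd ⟨c, h⟩ hl.2
  rw [h2, mul_one]
  refine Finset.prod_congr rfl fun l hl => ?_
  rw [Finset.mem_filter, Option.isSome_iff_exists] at hl
  obtain ⟨c, hc⟩ := hl.2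
  rw [hc]; rfl

/-- The power bookkeeping of the `Z`-chart: `ε₁ · Z^{n₁}/Z^{n₂} = (ε₁ Z)⁻¹ · Z^{−#poles} · Z^{n+1}`.
[folklore] -/
theorem zchart_powers {n np : ℕ} (hnp : np ≤ n + 1) {Z ε₁ : ℝ} (hZ : Z ≠ 0) (hε : ε₁ * ε₁ = 1)
    (P Lp Pa : ℝ) :
    ε₁ * P / Lp * (Z ^ (if np ≤ n then n - np else 0) / Z ^ (if np ≤ n then 0 else 1)) * Pa =
      P / Lp * (1 / (ε₁ * Z)) * (Pa * (1 / Z) ^ np) * Z ^ (n + 1) := by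
  have hinv : ε₁⁻¹ = ε₁ := inv_eq_of_mul_eq_one_right hε
  rw [one_div_pow, one_div, mul_inv, hinv, one_div]
  by_cases h : np ≤ n
  · rw [if_pos h, if_pos h, pow_zero, div_one]
    have hsplit : Z ^ (n + 1) = Z ^ np * Z * Z ^ (n - np) := by
      rw [← pow_succ, ← pow_add]; congr 1; omega
    rw [hsplit]
    field_simp
  · have hnp' : np = n + 1 := by omega
    rw [if_neg h, if_neg h, hnp', pow_zero, pow_one]
    field_simp

/-! ### The move -/

variable {n m' : ℕ} {s : KZ.IntegralRep (0 + 1 + (n + 1))} {M : Fin m' → Cf} {A Bd : Cf} {T : BData}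
  {p : MvPolynomial (Fin 0) ℚ} {a : Fin (n + 1) → Option Cf}

/-- The base cell `0 < Z < δ` of the `Z`-chart. [folklore] -/
theorem mem_cellZ (δ : ℚ) (Z : ℝ) : Z ∈ cell ![RebaseZero.mk 1 0, RebaseZero.mk (-1) δ] ↔ 0 < Z ∧ Z < δ := by
  simp only [cell, mem_setOf_eq, Fin.forall_fin_two, Matrix.cons_val_zero, Matrix.cons_val_one, ev_mk]
  push_cast
  constructor <;> rintro ⟨h1, h2⟩ <;> constructor <;> linarith

/-- Scaling a strictly monotone family by a positive constant and translating it. [folklore] -/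
theorem strictMono_affine_iff {f : Fin (n + 1) → ℝ} {Z t₀ : ℝ} (hZ : 0 < Z) :
    StrictMono (fun l => t₀ + f l * Z) ↔ StrictMono f := by
  constructor
  · intro h i j hij
    have := h hij
    dsimp only at this
    nlinarith
  · intro h i j hij
    have := h hij
    dsimp only
    nlinarith

/-- **The `Z`-chart blow-up of a pinched clean chain with all letters at the vertex level is
good.** Hypotheses: the base cell is exactly `{0 < ε₁ (y − y₀) < δ}` (`ε₁ = ±1`), both bounds
pass through `(y₀, t₀)`, the simple base pole sits at `y₀`, and every letter equals `t₀`.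
Then one change of variables lands literally in `GG 0 2 (n + 1)`.
[Kontsevich–Zagier 2001, §1.2, rule (2)] -/
theorem IsChain.good_blowZ (h : IsChain s M A Bd T p a) (y₀ t₀ ε₁ δ : ℚ) (hε₁ : ε₁ = 1 ∨ ε₁ = -1)
    (hcellI : ∀ y : ℝ, y ∈ cell M ↔ 0 < (ε₁ : ℝ) * (y - y₀) ∧ (ε₁ : ℝ) * (y - y₀) < δ)
    (hA0 : A.1 (Fin.last 0) * y₀ + A.2 = t₀) (hB0 : Bd.1 (Fin.last 0) * y₀ + Bd.2 = t₀)
    (hp : T.ℓ₂.2 = y₀) (hat : ∀ l c, a l = some c → c.2 = t₀) : Good (n + 1) (KZ.of s) := by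
  classical
  -- notation
  have hε2 : (ε₁ : ℝ) * ε₁ = 1 := by rcases hε₁ with rfl | rfl <;> norm_num
  have hεa : |(ε₁ : ℝ)| = 1 := by rcases hε₁ with rfl | rfl <;> norm_num
  have hε0 : (ε₁ : ℝ) ≠ 0 := fun h0 => by rw [h0, mul_zero] at hε2; exact zero_ne_one hε2
  set α : ℚ := A.1 (Fin.last 0) with hα
  set β : ℚ := Bd.1 (Fin.last 0) with hβ
  have hAv : ∀ Z : ℝ, ev A (y₀ + ε₁ * Z) = t₀ + α * ε₁ * Z := fun Z => by
    have h1 : (α : ℝ) * y₀ + A.2 = t₀ := by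
      have := congrArg (fun q : ℚ => (q : ℝ)) hA0; simp only [Rat.cast_add, Rat.cast_mul] at this; exact this
    rw [ev]; linear_combination h1
  have hBv : ∀ Z : ℝ, ev Bd (y₀ + ε₁ * Z) = t₀ + β * ε₁ * Z := fun Z => by
    have h1 : (β : ℝ) * y₀ + Bd.2 = t₀ := by
      have := congrArg (fun q : ℚ => (q : ℝ)) hB0; simp only [Rat.cast_add, Rat.cast_mul] at this; exact this
    rw [ev]; linear_combination h1
  set Mz : Fin 2 → Cf := ![RebaseZero.mk 1 0, RebaseZero.mk (-1) δ] with hMz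
  set Az : Cf := RebaseZero.mk 0 (ε₁ * α) with hAz
  set Bz : Cf := RebaseZero.mk 0 (ε₁ * β) with hBz
  have hAz0 : ∀ Z : ℝ, ev Az Z = ε₁ * α := fun Z => by rw [hAz, ev_mk]; push_cast; ring
  have hBz0 : ∀ Z : ℝ, ev Bz Z = ε₁ * β := fun Z => by rw [hBz, ev_mk]; push_cast; ring
  set R := gDom 0 (n + 1) 2 Mz (clo Az) (chi Bz) with hRdef
  set np : ℕ := (Finset.univ.filter fun l => (a l).isSome).card with hnp
  have hnp1 : np ≤ n + 1 := by
    have := Finset.card_filter_le Finset.univ (fun l => (a l).isSome)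
    rwa [Finset.card_univ, Fintype.card_fin] at this
  set n₁' : ℕ := if np ≤ n then n - np else 0 with hn₁'
  set n₂' : ℕ := if np ≤ n then 0 else 1 with hn₂'
  have h12' : n₁' = 0 ∨ n₂' = 0 := by
    by_cases hle : np ≤ n
    · exact Or.inr (by rw [hn₂', if_pos hle])
    · exact Or.inl (by rw [hn₁', if_neg hle])
  set a' : Fin (n + 1) → Option Cf := fun l => (a l).map fun _ => (0 : Cf) with ha'
  set f' := glit 0 (n + 1) (MvPolynomial.C ε₁ * p) T.L T.e 0 0 n₁' n₂' a' with hf'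
  set Ψ := zmap (k := n + 1) (ε₁ : ℝ) (y₀ : ℝ) (t₀ : ℝ) with hΨ
  -- membership
  have mR : ∀ w, w ∈ R ↔ (0 < yv w ∧ yv w < δ) ∧ (ε₁ : ℝ) * α < tv w 0 ∧ StrictMono (tv w) ∧
      tv w (Fin.last n) < ε₁ * β := fun w => by
    rw [hRdef, mem_chain, mem_cellZ, hAz0, hBz0]
  have htv : ∀ w, tv (Ψ w) = fun l => (t₀ : ℝ) + tv w l * yv w := fun w => funext (tv_zmap _ _ _ w)
  have hmem : ∀ w, w ∈ R ↔ Ψ w ∈ s.domain := fun w => by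
    rw [mR, h.mem, htv, hΨ, yv_zmap, hcellI, hAv, hBv]
    dsimp only
    have e1 : (ε₁ : ℝ) * (y₀ + ε₁ * yv w - y₀) = yv w := by linear_combination (yv w) * hε2
    rw [e1]
    constructor
    · rintro ⟨⟨hZ0, hZδ⟩, h1, h2, h3⟩
      refine ⟨⟨hZ0, hZδ⟩, by nlinarith, (strictMono_affine_iff hZ0).2 h2, by nlinarith⟩
    · rintro ⟨⟨hZ0, hZδ⟩, h1, h2, h3⟩
      refine ⟨⟨hZ0, hZδ⟩, lt_of_mul_lt_mul_right ?_ hZ0.le, (strictMono_affine_iff hZ0).1 h2,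
        lt_of_mul_lt_mul_right ?_ hZ0.le⟩ <;> nlinarith
  -- the image
  have hyne : ∀ z ∈ s.domain, yv z ≠ (y₀ : ℝ) := fun z hz h0 => by
    have := (((hcellI _).1 ((h.mem z).1 hz).1)).1
    rw [h0, sub_self, mul_zero] at this
    exact lt_irrefl _ this
  have himg : Ψ '' R = s.domain := by
    ext z
    constructor
    · rintro ⟨w, hw, rfl⟩; exact (hmem w).1 hw
    · intro hz
      have hzz : Ψ (zinv (ε₁ : ℝ) y₀ t₀ z) = z := zmap_zinv _ _ _ hε2 (hyne z hz)
      exact ⟨zinv (ε₁ : ℝ) y₀ t₀ z, (hmem _).2 (by rw [hzz]; exact hz), hzz⟩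
  -- the integrand
  have hS : ∀ w ∈ R, s.integrand (Ψ w) = ((p.coeff 0 : ℚ) : ℝ) / (∏ j, ((T.L j).2 : ℝ) ^ T.e j) *
      (1 / ((ε₁ : ℝ) * yv w)) * ((∏ l, (a l).elim (1 : ℝ) fun _ => 1 / (tv w l - 0)) * (1 / yv w) ^ np) := by
    intro w hw
    rw [h.int ((hmem w).1 hw), glitB, glit_b0, h.n1, h.n2, pow_zero, pow_one, hp, hΨ, yv_zmap,
      add_sub_cancel_left, one_div, one_div]
    congr 1
    rw [hnp, ← prod_elim_const, ← prod_elim_mul]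
    refine Finset.prod_congr rfl fun l _ => ?_
    rcases hal : a l with _ | c
    · rfl
    · have hc : ev c (y₀ + ε₁ * yv w) = t₀ := by
        rw [ev, h.a0 l c hal, hat l c hal, Rat.cast_zero, zero_mul, zero_add]
      simp only [Option.elim_some, tv_zmap, hc, sub_zero]
      rw [show (t₀ : ℝ) + tv w l * yv w - t₀ = tv w l * yv w by ring]
      simp only [one_div, mul_inv]
  have hF : ∀ w, f' w = (ε₁ : ℝ) * ((p.coeff 0 : ℚ) : ℝ) / (∏ j, ((T.L j).2 : ℝ) ^ T.e j) *
      ((yv w) ^ n₁' / (yv w) ^ n₂') * ∏ l, (a l).elim (1 : ℝ) fun _ => 1 / (tv w l - 0) := by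
    intro w
    rw [hf', glit_b0, MvPolynomial.coeff_C_mul, Rat.cast_mul, Prod.snd_zero, Rat.cast_zero, sub_zero,
      mul_div_assoc]
    congr 1
    refine Finset.prod_congr rfl fun l _ => ?_
    rcases hal : a l with _ | c
    · simp [ha', hal]
    · simp only [ha', hal, Option.map_some, Option.elim_some, ev, Prod.fst_zero, Pi.zero_apply,
        Prod.snd_zero, Rat.cast_zero, zero_mul, add_zero]
  have hint : ∀ w ∈ R, f' w = s.integrand (Ψ w) * |(zlin (ε₁ : ℝ) w).det| := by
    intro w hw
    have hZ0 : 0 < yv w := ((mR w).1 hw).1.1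
    rw [zlin_det, abs_mul, hεa, one_mul, abs_of_pos (pow_pos hZ0 _), hS w hw, hF w, hn₁', hn₂']
    exact zchart_powers hnp1 hZ0.ne' hε2 _ _ _
  -- rule (2)
  have hsaR : IsSemialgebraic ℚ R := isSemialgebraic_gDom _ _ _ _
  obtain ⟨s', hs'd, hs'i, hrel⟩ := cov_pull s hsaR Ψ (zlin (ε₁ : ℝ))
    (by rw [hΨ]; exact isSemialgebraicMapOn_zmap ε₁ y₀ t₀ hsaR)
    (fun w _ => (hasFDerivAt_zmap _ _ _ w).hasFDerivWithinAt)
    (zmap_injOn _ _ _ hε0 fun w hw => ((mR w).1 hw).1.1.ne') himg f'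
    (isSemialgebraicFunOn_glit hsaR _ _ _ _ _ _ _ _) hint
  -- the blown-up representation is literally in `GG 0 2 (n + 1)`
  have hR : ∀ Z ∈ cell Mz, |Z| ≤ δ := fun Z hZ => by
    rw [mem_cellZ] at hZ
    rw [abs_of_pos hZ.1]; exact hZ.2.le
  refine RebaseZero.good_of_sub_mem hrel (RebaseZero.good_of_mem (mem_GGset_two s' Mz T.L T.e
    (MvPolynomial.C ε₁ * p) 0 0 a' (clo Az) (chi Bz) h12' (fun l c hc => ?_) (fun l c hc => ?_)
    (by rw [hs'd]; exact isBounded_chainDom Mz hR Az Bz) hs'd fun w _ => by rw [hs'i]))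
  · rcases hal : a l with _ | c₀
    · simp [ha', hal] at hc
    · simp only [ha', hal, Option.map_some, Option.some.injEq] at hc
      rw [← hc]; rfl
  · left
    rcases hc with hc | hc
    · rw [clo_eq_inr hc]; rfl
    · rw [chi_eq_inr hc]; rfl

end RebaseChain

/-- Registered support goal of this file (part of `rebaseSimpleZeroMany_common`): the `Z`-chart
blow-up of a pinched clean chain of `n + 1` fibres with all letters at the vertex level and the
base pole at the pinch abscissa lands in `GG 0 2 (n + 1)` (`RebaseChain.IsChain.good_blowZ`). -/
theorem rebaseSimpleZeroMany_chainBlowZ (n m' : ℕ) (s : KZ.IntegralRep (0 + 1 + (n + 1))) (M : Fin m' → (Fin (0 + 1) → ℚ) × ℚ) (A Bd : (Fin (0 + 1) → ℚ) × ℚ) (T : RebaseZero.BData) (p : MvPolynomial (Fin 0) ℚ) (a : Fin (n + 1) → Option ((Fin (0 + 1) → ℚ) × ℚ)) (h : RebaseChain.IsChain s M A Bd T p a) (y₀ t₀ ε₁ δ : ℚ) (hε₁ : ε₁ = 1 ∨ ε₁ = -1) (hcellI : ∀ y : ℝ, y ∈ RebaseZero.cell M ↔ 0 < (ε₁ : ℝ)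 * (y - y₀) ∧ (ε₁ : ℝ) * (y - y₀) < δ) (hA0 : A.1 (Fin.last 0) * y₀ + A.2 = t₀) (hB0 : Bd.1 (Fin.last 0) * y₀ + Bd.2 = t₀) (hp : T.ℓ₂.2 = y₀) (hat : ∀ l c, a l = some c → c.2 = t₀) : RebaseZero.Good (n + 1) (KZ.of s) :=
  h.good_blowZ y₀ t₀ ε₁ δ hε₁ hcellI hA0 hB0 hp hat

end Summit.KontsevichZagierPeriods.ArrangementNormalForm.JanusBands
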